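import Literature.Analysis.FluidPDE.HardSphereDynamicsProofs
import Literature.MathematicalPhysics.StatisticalMechanics.SpecificRelativeEntropyProofs
import Literature.MathematicalPhysics.KineticTheory.HardSphereEulerProofs

/-!
# Relative entropy along a hard-sphere flow: the Liouville transport identity (helper for the dock of route OneFlightGossipEngine)

Step (i) of the entropy clock behind the Assembly / dock of route OneFlightGossipEngine
(stmt-AtomisticToContinuum-14647 ≡ crux stmt-14680 `ClampedCurrentsDock` given B1′; also TwoClocks
stmt-13735 and every relative-entropy route): for a hard-sphere flow `Φ` (Alexander's hypothesis
structure: conull invariant good set, group property, Liouville invariance) the relative entropy of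
the law at time `t` with respect to ANY Liouville-absolutely-continuous reference equals the relative
entropy of the INITIAL law with respect to the reference pulled back along the flow:

* `hardSphereFlow_map_flow_neg_map_flow` — `(Φ_t)_* (Φ_{-t})_* ν = ν` for `ν ≪ dZ`;
* `klDiv_lawAt_eq` — `KL((Φ_t)_* μ ‖ ν) = KL(μ ‖ (Φ_{-t})_* ν)` for finite `μ, ν ≪ dZ`
  (transport of `klDiv` along the a.e.-invertible map `Φ_t`,
  `Literature.MathematicalPhysics.StatisticalMechanics.klDiv_map_eq_of_leftInvOn` on the good set);
* `klDiv_lawAt_withDensity_eq` — density form: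
  `KL((Φ_t)_* (f dZ) ‖ g dZ) = KL(f dZ ‖ (g ∘ Φ_t) dZ)` (mild Liouville equation
  `HardSphereFlow.lawAt_withDensity_holds`);
* `klDiv_lawAt_localGibbsLaw_eq` — the hard-sphere/local-Gibbs currency of the dock: with
  `λ_N = localGibbsLaw σ a₀ u₀ θ₀ N Φ` and the reference `ψ = localGibbsLaw σ a u θ N Φ` (e.g. the Euler
  parameters at time `t`), `KL(lawAt Φ λ_N t ‖ ψ) = KL(λ_N ‖ (ψ-density ∘ Φ_t) dZ)`; so
  `H_N(t) - H_N(0) = E_{λ_N}[log ψ₀ - log ψ_t ∘ Φ_t]` whenever the entropies are finite — the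
  "entropy production" is an explicit one-body-plus-contact observable of the trajectory, which the
  window-LD inputs of the dock are designed to consume (Yau 1991; Olla–Varadhan–Yau 1993 §3).

Pure measure theory over the tree's prelude; no dynamics beyond the `HardSphereFlow` axioms.
-/

noncomputable section

open MeasureTheory InformationTheory Set Filter
open scoped ENNReal

namespace Summit.AtomisticToContinuum.HydrodynamicLimit.Theorems

open Literature.Analysis.FluidPDE

section General

variable {d : Type*} [Fintype d] {X : Type*} [MeasureSpace X] [TopologicalSpace X] {N : ℕ}
  {G : Geometry d X} {ε : ℝ}

/-- A Liouville-absolutely-continuous law gives full mass to the good set of the flow. [folklore] -/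
theorem hardSphereFlow_ae_mem_good_of_absolutelyContinuous (Φ : HardSphereFlow G ε N) {ν : Measure (Config N d X)}
    (hν : ν ≪ liouville G N ε) : ∀ᵐ z ∂ν, z ∈ Φ.good :=
  hν Φ.measure_compl_good

/-- Pull back then push forward along the flow recovers a Liouville-absolutely-continuous law:
`(Φ_t)_* (Φ_{-t})_* ν = ν` (group property on the conull good set). [folklore] -/
theorem hardSphereFlow_map_flow_neg_map_flow (Φ : HardSphereFlow G ε N) (ν : Measure (Config N d X))
    (hν : ν ≪ liouville G N ε) (t : ℝ) :
    (ν.map (Φ.flow (-t))).map (Φ.flow t) = ν := by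
  rw [Measure.map_map (Φ.measurable_flow t) (Φ.measurable_flow (-t))]
  have hae : (Φ.flow t ∘ Φ.flow (-t)) =ᵐ[ν] id := by
    filter_upwards [hardSphereFlow_ae_mem_good_of_absolutelyContinuous Φ hν] with z hz
    have h := Φ.flow_neg_flow (-t) hz
    simp only [neg_neg] at h
    exact h
  rw [Measure.map_congr hae, Measure.map_id]

/-- **Transport of relative entropy along a hard-sphere flow.** For finite laws `μ, ν ≪ dZ`,
`KL((Φ_t)_* μ ‖ ν) = KL(μ ‖ (Φ_{-t})_* ν)`: `Φ_t` is injective on the conull invariant good set with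
inverse `Φ_{-t}`, so the Kullback–Leibler divergence is transported
(`klDiv_map_eq_of_leftInvOn`) after writing `ν = (Φ_t)_* (Φ_{-t})_* ν`.
[cite: OllaVaradhanYau1993, §3] -/
theorem klDiv_lawAt_eq (Φ : HardSphereFlow G ε N) (μ ν : Measure (Config N d X))
    [IsFiniteMeasure μ] [IsFiniteMeasure ν] (hμ : μ ≪ liouville G N ε)
    (hν : ν ≪ liouville G N ε) (t : ℝ) :
    klDiv (Φ.lawAt μ t) ν = klDiv μ (ν.map (Φ.flow (-t))) := by
  have hb : (ν.map (Φ.flow (-t))) Φ.goodᶜ = 0 := by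
    rw [Measure.map_apply (Φ.measurable_flow (-t)) Φ.measurableSet_good.compl]
    refine hν (measure_mono_null (fun z hz => ?_) Φ.measure_compl_good)
    simp only [mem_preimage, mem_compl_iff] at hz ⊢
    exact fun hz' => hz (Φ.mapsTo_good (-t) hz')
  have key := Literature.MathematicalPhysics.StatisticalMechanics.klDiv_map_eq_of_leftInvOn
    (a := μ) (b := ν.map (Φ.flow (-t))) (Φ.measurable_flow t) (Φ.measurable_flow (-t))
    Φ.measurableSet_good (hμ Φ.measure_compl_good) hb (fun z hz => Φ.flow_neg_flow t hz)
  rw [hardSphereFlow_map_flow_neg_map_flow Φ ν hν t] at key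
  rw [HardSphereFlow.lawAt_eq, key]

/-- **Density form of the transport identity** (mild Liouville equation): for measurable
densities `f, g` with finite laws, `KL((Φ_t)_* (f dZ) ‖ g dZ) = KL(f dZ ‖ (g ∘ Φ_t) dZ)`.
[cite: OllaVaradhanYau1993, §3] -/
theorem klDiv_lawAt_withDensity_eq (Φ : HardSphereFlow G ε N) {f g : Config N d X → ℝ≥0∞}
    (hg : Measurable g) [IsFiniteMeasure ((liouville G N ε).withDensity f)]
    [IsFiniteMeasure ((liouville G N ε).withDensity g)] (t : ℝ) :
    klDiv (Φ.lawAt ((liouville G N ε).withDensity f) t) ((liouville G N ε).withDensity g) =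
      klDiv ((liouville G N ε).withDensity f)
        ((liouville G N ε).withDensity fun z => g (Φ.flow t z)) := by
  rw [klDiv_lawAt_eq Φ _ _ (withDensity_absolutelyContinuous _ _)
    (withDensity_absolutelyContinuous _ _) t]
  congr 1
  have h := HardSphereFlow.lawAt_withDensity_holds Φ hg (-t)
  rw [HardSphereFlow.lawAt_eq] at h
  rw [h]
  congr 1
  funext z
  simp [HardSphereFlow.transportDensity]

end General

open Literature.MathematicalPhysics.KineticTheory

/-- **The entropy clock, step (i), in the dock's currency.** For the hard-sphere system on `𝕋³` at
reduced diameter `σ` started from the local Gibbs law `λ_N = localGibbsLaw σ a₀ u₀ θ₀ N Φ`, and any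
local Gibbs reference `ψ = localGibbsLaw σ a u θ N Φ` with continuous profiles (typically the Euler
parameters at time `t`), both finite: the relative entropy of the law at time `t` with respect to `ψ`
equals the relative entropy of `λ_N` with respect to the Liouville measure with density the
reference canonical density composed with `Φ_t`:
`KL(lawAt Φ λ_N t ‖ ψ) = KL(λ_N ‖ (ψ-density ∘ Φ_t) dZ)`. [cite: Yau1991, §2] -/
theorem klDiv_lawAt_localGibbsLaw_eq {σ : ℝ} {a₀ θ₀ a θ : T3 → ℝ} {u₀ u : T3 → V3} (N : ℕ)
    (Φ : HardSphereFlow (Torus.geometry (Fin 3)) (hsDiameter σ N) (N + 1))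
    [IsFiniteMeasure (localGibbsLaw σ a₀ u₀ θ₀ N Φ)] [IsFiniteMeasure (localGibbsLaw σ a u θ N Φ)]
    (ha : Continuous a) (hθ : Continuous θ) (hu : Continuous u) (t : ℝ) :
    klDiv (Φ.lawAt (localGibbsLaw σ a₀ u₀ θ₀ N Φ) t) (localGibbsLaw σ a u θ N Φ) =
      klDiv (localGibbsLaw σ a₀ u₀ θ₀ N Φ)
        ((liouville (Torus.geometry (Fin 3)) (N + 1) (hsDiameter σ N)).withDensity fun z =>
          ENNReal.ofReal (canonicalDensity (Torus.geometry (Fin 3)) (hsDiameter σ N) (N + 1)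
            (localGibbsProfile a u θ) (Φ.flow t z))) := by
  have hmeas : Measurable fun z => ENNReal.ofReal (canonicalDensity (Torus.geometry (Fin 3))
      (hsDiameter σ N) (N + 1) (localGibbsProfile a u θ) z) :=
    (measurable_canonicalDensity _ _ (measurable_localGibbsProfile ha hθ hu)).ennreal_ofReal
  have h1 : localGibbsLaw σ a₀ u₀ θ₀ N Φ = (liouville (Torus.geometry (Fin 3)) (N + 1)
      (hsDiameter σ N)).withDensity fun z => ENNReal.ofReal (canonicalDensity (Torus.geometry (Fin 3))
        (hsDiameter σ N) (N + 1) (localGibbsProfile a₀ u₀ θ₀) z) := rfl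
  have h2 : localGibbsLaw σ a u θ N Φ = (liouville (Torus.geometry (Fin 3)) (N + 1)
      (hsDiameter σ N)).withDensity fun z => ENNReal.ofReal (canonicalDensity (Torus.geometry (Fin 3))
        (hsDiameter σ N) (N + 1) (localGibbsProfile a u θ) z) := rfl
  have i1 : IsFiniteMeasure ((liouville (Torus.geometry (Fin 3)) (N + 1)
      (hsDiameter σ N)).withDensity fun z => ENNReal.ofReal (canonicalDensity (Torus.geometry (Fin 3))
        (hsDiameter σ N) (N + 1) (localGibbsProfile a₀ u₀ θ₀) z)) := h1 ▸ inferInstance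
  have i2 : IsFiniteMeasure ((liouville (Torus.geometry (Fin 3)) (N + 1)
      (hsDiameter σ N)).withDensity fun z => ENNReal.ofReal (canonicalDensity (Torus.geometry (Fin 3))
        (hsDiameter σ N) (N + 1) (localGibbsProfile a u θ) z)) := h2 ▸ inferInstance
  rw [h1, h2]
  exact klDiv_lawAt_withDensity_eq Φ hmeas t

end Summit.AtomisticToContinuum.HydrodynamicLimit.Theorems

end
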